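import Mathlib
import HarnessLib
import Summits.HubbardSuperconductivity.HubbardSuperconductivity.Theses.ChiralWindow
import Summits.HubbardSuperconductivity.HubbardSuperconductivity.Theses.TorusCooperLog
import Summits.HubbardSuperconductivity.HubbardSuperconductivity.Theorems.BalabanIRBirEveryGroundStateSchur
import Summits.HubbardSuperconductivity.HubbardSuperconductivity.Theorems.BalabanIRBirEveryGroundState
import Literature.MathematicalPhysics.QuantumLattice.FinDimSpectrumSectorGibbsLimit
import Literature.MathematicalPhysics.QuantumLattice.FockRelabel

/-!
# Sketch — crux-ideate stmt-HubbardSuperconductivity-10438 (`ChiralWindow.CwThesis`), ideator 3, round 1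

First lemmas of the three crux idea cards (elaboration; proofs where cheap):

* card `crossing-line-penalty-pointwise`: `ChiralPenaltyResponse` (C⁺), the PROVED glue
  `cwThesis_of_chiralPenaltyResponse : C⁺ → TorusCooperLog.PenaltyResponseLRO → CwThesis`, and the
  thermal transfer `thermalPenaltyDescent` (sector Peierls–Bogoliubov + entropy sandwich; sorried,
  provable now).
* card `summable-accident-doping-selection`: `dopingSelection` (PROVED: a summable family of
  exceptional doping sets misses a point of the window), `PerVolumeGoodFillings` (C⁺) and the
  bookkeeping `cwThesis_of_perVolumeGoodFillings` (sorried, M-sized).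
* card `chiral-doublet-point-group-schur`: `doublet_cross_term_zero` and `doublet_min_of_sectors`
  (PROVED: a Hermitian symmetry with characters ±1 on the two members of the ground doublet kills the
  cross term of every invariant observable, so no superposition can lose the order).
-/

noncomputable section

namespace Summit.HubbardSuperconductivity.HubbardSuperconductivity.Cruxes.CwThesis.Ideator3

open Filter Set Matrix MeasureTheory
open Literature.MathematicalPhysics.QuantumLattice Literature.Probability.LatticeModels
open Summit.HubbardSuperconductivity.HubbardSuperconductivity.Theses
open Summit.HubbardSuperconductivity.HubbardSuperconductivity.Theorems
open scoped ComplexOrder ENNReal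

/-! ## Card `crossing-line-penalty-pointwise` -/

/-- The penalised sector energy `E_L(U; κ)` at filling `N_L(δ)`, `L = 2(k+1)`:
`minEnergyOn (hubbardTorus 2 L 1 U + (κ/L⁴) Δ_d†Δ_d) (szSector N_L 0)` (TorusCooperLog's object). -/
def penalisedSectorEnergy (U δ κ : ℝ) (k : ℕ) : ℝ :=
  Matrix.minEnergyOn
    (hubbardTorus 2 (2 * (k + 1)) 1 U +
      ((κ / ((2 * (k + 1) : ℕ) : ℝ) ^ 4 : ℝ) : ℂ) •
        ((pairField dWaveFormFactor (2 * (k + 1)))ᴴ * pairField dWaveFormFactor (2 * (k + 1))))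
    (szSector (2 * ⌊(1 - δ) * ((2 * (k + 1) : ℕ) : ℝ) ^ 2 / 2⌋₊) 0)

/-- **C⁺ (card `crossing-line-penalty-pointwise`)**: intensive pair-penalty response, POINTWISE at a
`U`-dependent doping `δ_U` of the window (intended: on the Kohn–Luttinger crossing line). -/
def ChiralPenaltyResponse : Prop :=
  ∃ U₀ : ℝ, 0 < U₀ ∧ ∀ U ∈ Set.Ioo (0:ℝ) U₀, ∃ δ ∈ Set.Icc (3/10 : ℝ) (12/25),
    ∃ κ : ℝ, 0 < κ ∧ ∃ c : ℝ, 0 < c ∧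
      ∀ᶠ k : ℕ in atTop, c * κ ≤ penalisedSectorEnergy U δ κ k - penalisedSectorEnergy U δ 0 k

/-- GLUE (pure logic, PROVED): `ChiralPenaltyResponse` and TorusCooperLog's pointwise support item
`PenaltyResponseLRO` (stmt-HubbardSuperconductivity-10879) give `CwThesis`, with `δ_U` := the
penalty doping. This is the composition `CwThesis_of` of the line, minus the construction. -/
theorem cwThesis_of_chiralPenaltyResponse (hP : ChiralPenaltyResponse)
    (hG : TorusCooperLog.PenaltyResponseLRO) : ChiralWindow.CwThesis := by
  obtain ⟨U₀, hU₀, hU⟩ := hP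
  refine ⟨U₀, hU₀, fun U hUm => ?_⟩
  obtain ⟨δ, hδ, κ, hκ, c, hc, hev⟩ := hU U hUm
  refine ⟨δ, hδ, ?_⟩
  have key := hG U δ κ c hκ hc
  have hev' : ∀ᶠ k : ℕ in atTop, c * κ ≤
      Matrix.minEnergyOn (hubbardTorus 2 (2 * (k + 1)) 1 U +
        ((κ / ((2 * (k + 1) : ℕ) : ℝ) ^ 4 : ℝ) : ℂ) •
          ((pairField dWaveFormFactor (2 * (k + 1)))ᴴ * pairField dWaveFormFactor (2 * (k + 1))))
        (szSector (2 * ⌊(1 - δ) * ((2 * (k + 1) : ℕ) : ℝ) ^ 2 / 2⌋₊) 0) -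
      Matrix.minEnergyOn (hubbardTorus 2 (2 * (k + 1)) 1 U)
        (szSector (2 * ⌊(1 - δ) * ((2 * (k + 1) : ℕ) : ℝ) ^ 2 / 2⌋₊) 0) := by
    filter_upwards [hev] with k hk
    have h0 : penalisedSectorEnergy U δ 0 k =
        Matrix.minEnergyOn (hubbardTorus 2 (2 * (k + 1)) 1 U)
          (szSector (2 * ⌊(1 - δ) * ((2 * (k + 1) : ℕ) : ℝ) ^ 2 / 2⌋₊) 0) := by
      simp [penalisedSectorEnergy]
    rw [h0] at hk
    exact hk
  exact key hev'

/-- Sector Gibbs average `tr (P_K e^{-βH} A) / tr (P_K e^{-βH})` (the object of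
`tendsto_sectorGibbsAverage_atTop`, written out; `P_K` the orthogonal projection matrix). -/
def sectorGibbsAvg {n : Type*} [Fintype n] [DecidableEq n] (β : ℝ) (H : Matrix n n ℂ)
    (K : Submodule ℂ (n → ℂ)) (A : Matrix n n ℂ) : ℂ :=
  (projMatrix (K.map ((WithLp.linearEquiv 2 ℂ (n → ℂ)).symm :
      (n → ℂ) →ₗ[ℂ] EuclideanSpace ℂ n)) * Matrix.gibbsWeight β H * A).trace /
    (projMatrix (K.map ((WithLp.linearEquiv 2 ℂ (n → ℂ)).symm :
      (n → ℂ) →ₗ[ℂ] EuclideanSpace ℂ n)) * Matrix.gibbsWeight β H).trace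

/-- **Thermal transfer (card `crossing-line-penalty-pointwise`, C⁺⁺ → C⁺; provable now, M-sized).**
Sector Peierls–Bogoliubov inequality `F_K(H + κQ) - F_K(H) ≥ κ ⟨Q⟩_{β,K,H+κQ}` plus the entropy
sandwich `E_K - (log dim K)/β ≤ F_K ≤ E_K`: the penalty response of the sector GROUND energies is
bounded below by `κ` times ONE Gibbs expectation of the penalty in the PENALISED sector ensemble,
minus the entropy price `(log dim K)/β`. With `dim K ≤ 4^{L²}` and `β = M L²` the price is `log 4 / M`. -/
theorem thermalPenaltyDescent {n : Type*} [Fintype n] [DecidableEq n] (H Q : Matrix n n ℂ)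
    (K : Submodule ℂ (n → ℂ)) (hH : H.IsHermitian) (hQ : Q.IsHermitian)
    (hHK : ∀ v ∈ K, H *ᵥ v ∈ K) (hQK : ∀ v ∈ K, Q *ᵥ v ∈ K) (hK : K ≠ ⊥)
    {β κ : ℝ} (hβ : 0 < β) (hκ : 0 ≤ κ) :
    κ * (sectorGibbsAvg β (H + (κ : ℂ) • Q) K Q).re - Real.log (Module.finrank ℂ K) / β ≤
      (H + (κ : ℂ) • Q).minEnergyOn K - H.minEnergyOn K := by
  sorry

/-! ## Card `summable-accident-doping-selection` -/

/-- **Selection lemma (PROVED).** A family of exceptional doping sets whose (outer) Lebesgue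
measures have sum below the length of the window misses some doping of the window at EVERY volume.
Contrast `exists_mem_Ioo_forall_not_mem` (BalabanIR, countable bad COUPLINGS): bad DOPINGS come in
intervals of length `2/L²` per bad filling, so countability is useless and summability is the
condition. -/
theorem dopingSelection {a b : ℝ} (hab : a < b) (B : ℕ → Set ℝ)
    (hB : (∑' L, volume (B L)) < ENNReal.ofReal (b - a)) :
    ∃ δ ∈ Set.Icc a b, ∀ L, δ ∉ B L := by
  by_contra hcon
  push Not at hcon
  have hsub : Set.Icc a b ⊆ ⋃ L, B L := fun δ hδ => by
    obtain ⟨L, hL⟩ := hcon δ hδ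
    exact Set.mem_iUnion.mpr ⟨L, hL⟩
  have h1 : volume (Set.Icc a b) ≤ ∑' L, volume (B L) :=
    (measure_mono hsub).trans (measure_iUnion_le B)
  rw [Real.volume_Icc] at h1
  exact absurd (h1.trans_lt hB) (lt_irrefl _)

/-- Per-volume goodness at `(U, δ, a, L)`: EVERY normalised `(N_L(δ), S^z = 0)`-sector ground state of
`hubbardTorus 2 L 1 U` has `re ⟨ψ, Δ_d†Δ_d ψ⟩ ≥ a L⁴`. -/
def GoodAt (U δ a : ℝ) (L : ℕ) [NeZero L] : Prop :=
  ∀ ψ : Fock (Orb (FermionTorus 2 L)), star ψ ⬝ᵥ ψ = 1 →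
    IsGroundStateInSector (hubbardTorus 2 L 1 U) (2 * ⌊(1 - δ) * (L : ℝ) ^ 2 / 2⌋₊) 0 ψ →
      a * (L : ℝ) ^ 4 ≤ (expect ((pairField dWaveFormFactor L)ᴴ * pairField dWaveFormFactor L) ψ).re

/-- **C⁺ (card `summable-accident-doping-selection`)**: for every weak `U` there are a sub-window
`[a₁,b₁] ⊆ [3/10,12/25]`, a floor `a > 0`, a threshold `L₀` and exceptional doping sets `B_L` of
SUMMABLE measure (sum `< b₁ - a₁`) such that every even `L ≥ L₀` is good at every non-exceptional
doping. One `δ_U` good at all large even `L` then exists by `dopingSelection`. -/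
def PerVolumeGoodFillings : Prop :=
  ∃ U₀ : ℝ, 0 < U₀ ∧ ∀ U ∈ Set.Ioo (0:ℝ) U₀, ∃ a₁ b₁ : ℝ, 3/10 ≤ a₁ ∧ a₁ < b₁ ∧ b₁ ≤ 12/25 ∧
    ∃ a : ℝ, 0 < a ∧ ∃ L₀ : ℕ, ∃ B : ℕ → Set ℝ,
      (∑' L, volume (B L)) < ENNReal.ofReal (b₁ - a₁) ∧
      ∀ k : ℕ, L₀ ≤ 2 * (k + 1) → ∀ δ ∈ Set.Icc a₁ b₁, δ ∉ B (2 * (k + 1)) →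
        GoodAt U δ a (2 * (k + 1))

/-- Bookkeeping (sorried, M-sized, provable now): `PerVolumeGoodFillings → CwThesis`
(`dopingSelection`, then eventual floor ⇒ `HasLongRangeOrder` of the pulled-back pair correlation
along even sides as in `Theorems.wcbcsThesis_of_eventually_le` / `hasTorusLRO_of_eventually_le`). -/
theorem cwThesis_of_perVolumeGoodFillings (h : PerVolumeGoodFillings) : ChiralWindow.CwThesis := by
  obtain ⟨U₀, hU₀, hU⟩ := h
  refine ⟨U₀, hU₀, fun U hUm => ?_⟩
  obtain ⟨a₁, b₁, ha₁, hab, hb₁, a, ha, L₀, B, hB, hgood⟩ := hU U hUm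
  obtain ⟨δ, hδ, hδB⟩ := dopingSelection hab B hB
  refine ⟨δ, ⟨le_trans ha₁ hδ.1, le_trans hδ.2 hb₁⟩, fun N ψ hadm => ?_⟩
  refine hasLRO_of_forall_groundState_bound U δ a ha L₀ (fun L _ hL hev φ hgs hunit => ?_) N ψ hadm
  obtain ⟨k, hk⟩ := hev
  -- `L = k + k` is a positive even side: write it as `2 * (k' + 1)`
  have hLpos : 0 < L := Nat.pos_of_ne_zero (NeZero.ne L)
  obtain ⟨k', rfl⟩ : ∃ k', k = k' + 1 := ⟨k - 1, by omega⟩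
  have hL2 : L = 2 * (k' + 1) := by omega
  subst hL2
  exact hgood k' hL δ hδ (hδB _) φ hunit hgs

/-! ## Card `chiral-doublet-point-group-schur` -/

/-- **Doublet lemma (PROVED).** A Hermitian symmetry `S` commuting with the observable `P`, with
`S u = u`, `S v = -v` (the two members of the chiral tunnelling doublet carry DIFFERENT characters
of a lattice mirror), kills the cross term: `⟨u, P v⟩ = 0`. -/
theorem doublet_cross_term_zero {n : Type*} [Fintype n] [DecidableEq n] {S P : Matrix n n ℂ}
    (hS : S.IsHermitian) (hcomm : S * P = P * S) {u v : n → ℂ}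
    (hu : S *ᵥ u = u) (hv : S *ᵥ v = -v) : star u ⬝ᵥ (P *ᵥ v) = 0 := by
  have h1 : star u ⬝ᵥ (P *ᵥ v) = star u ⬝ᵥ (S *ᵥ (P *ᵥ v)) := by
    rw [← star_mulVec_dotProduct_of_isHermitian hS u (P *ᵥ v), hu]
  have h2 : S *ᵥ (P *ᵥ v) = -(P *ᵥ v) := by
    rw [mulVec_mulVec, hcomm, ← mulVec_mulVec, hv, mulVec_neg]
  rw [h2, dotProduct_neg] at h1
  have h3 : 2 * (star u ⬝ᵥ (P *ᵥ v)) = 0 := by linear_combination h1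
  exact (mul_eq_zero.mp h3).resolve_left two_ne_zero

/-- **No superposition loses the order (PROVED).** Under the doublet lemma's hypotheses, for a
Hermitian `P` with `re ⟨u, P u⟩ ≥ a` and `re ⟨v, P v⟩ ≥ a` on the unit vectors `u ⊥ v`, every unit
superposition `ψ = α u + β v` has `re ⟨ψ, P ψ⟩ ≥ a`. -/
theorem doublet_min_of_sectors {n : Type*} [Fintype n] [DecidableEq n] {S P : Matrix n n ℂ}
    (hS : S.IsHermitian) (hP : P.IsHermitian) (hcomm : S * P = P * S) {u v : n → ℂ}
    (hu : S *ᵥ u = u) (hv : S *ᵥ v = -v) (hu1 : star u ⬝ᵥ u = 1) (hv1 : star v ⬝ᵥ v = 1)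
    (huv : star u ⬝ᵥ v = 0) {a : ℝ} (hua : a ≤ (star u ⬝ᵥ (P *ᵥ u)).re)
    (hva : a ≤ (star v ⬝ᵥ (P *ᵥ v)).re) (α β : ℂ) (hαβ : ‖α‖ ^ 2 + ‖β‖ ^ 2 = 1) :
    a ≤ (star (α • u + β • v) ⬝ᵥ (P *ᵥ (α • u + β • v))).re := by
  have hcross : star u ⬝ᵥ (P *ᵥ v) = 0 := doublet_cross_term_zero hS hcomm hu hv
  have hcross' : star v ⬝ᵥ (P *ᵥ u) = 0 := by
    rw [← star_mulVec_dotProduct_of_isHermitian hP v u, star_dotProduct, hcross, star_zero]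
  have hexp : star (α • u + β • v) ⬝ᵥ (P *ᵥ (α • u + β • v)) =
      star α * α * (star u ⬝ᵥ (P *ᵥ u)) + star β * β * (star v ⬝ᵥ (P *ᵥ v)) := by
    simp only [mulVec_add, mulVec_smul, star_add, star_smul, add_dotProduct, dotProduct_add,
      smul_dotProduct, dotProduct_smul, smul_eq_mul, hcross, hcross', mul_zero, add_zero, zero_add]
    ring
  rw [hexp]
  have hα : star α * α = ((‖α‖ ^ 2 : ℝ) : ℂ) := by
    rw [Complex.star_def, Complex.conj_mul', Complex.ofReal_pow]
  have hβ : star β * β = ((‖β‖ ^ 2 : ℝ) : ℂ) := by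
    rw [Complex.star_def, Complex.conj_mul', Complex.ofReal_pow]
  rw [hα, hβ, Complex.add_re, Complex.re_ofReal_mul, Complex.re_ofReal_mul]
  have h1 : ‖α‖ ^ 2 * a ≤ ‖α‖ ^ 2 * (star u ⬝ᵥ (P *ᵥ u)).re :=
    mul_le_mul_of_nonneg_left hua (sq_nonneg _)
  have h2 : ‖β‖ ^ 2 * a ≤ ‖β‖ ^ 2 * (star v ⬝ᵥ (P *ᵥ v)).re :=
    mul_le_mul_of_nonneg_left hva (sq_nonneg _)
  have h3 : a = ‖α‖ ^ 2 * a + ‖β‖ ^ 2 * a := by rw [← add_mul, hαβ, one_mul]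
  linarith


/-! ### Typed next objects of card `chiral-doublet-point-group-schur` (fine sectors) -/

section FineSectors

variable (L : ℕ) [NeZero L]

/-- Isotypic projector of a character `Γ` of `D₄` on `Fock (Orb (FermionTorus 2 L))`:
`(dim Γ / 8) Σ_γ χ_Γ(γ) U_γ` with `U_γ = fockD4 γ` (for the four 1-dim characters `dim Γ = 1`). -/
def isoProjD4 (Γ : D4Irrep) :
    Matrix (Finset (Orb (FermionTorus 2 L))) (Finset (Orb (FermionTorus 2 L))) ℂ :=
  ((Γ.dim : ℂ) / 8) • ∑ γ : DihedralGroup 4,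
    ((D4Irrep.char Γ γ : ℝ) : ℂ) • (fockD4 (L := L) γ).val

/-- The zero-momentum, `Γ`-isotypic FINE SECTOR inside the `(N, S^z = 0)` sector. -/
def fineSector (N : ℕ) (Γ : D4Irrep) : Submodule ℂ (Fock (Orb (FermionTorus 2 L))) :=
  szSector N 0 ⊓ LinearMap.ker (Matrix.toLin' (isoProjD4 L Γ) - LinearMap.id) ⊓
    ⨅ v : TorusSite 2 L, LinearMap.ker
      (Matrix.toLin' (fockTranslate (d := 2) (L := L) v).val - LinearMap.id)

/-- Ground eigenspace of `H` inside an (invariant) subspace `K`: `K ⊓ ker (H - minEnergyOn H K)`. -/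
def groundSpaceOn (H : Matrix (Finset (Orb (FermionTorus 2 L))) (Finset (Orb (FermionTorus 2 L))) ℂ)
    (K : Submodule ℂ (Fock (Orb (FermionTorus 2 L)))) : Submodule ℂ (Fock (Orb (FermionTorus 2 L))) :=
  K ⊓ Module.End.eigenspace (Matrix.toLin' H) ((Matrix.minEnergyOn H K : ℝ) : ℂ)

/-- **FineBottomLRO** (tracial, per fine sector): every 1-dim-character zero-momentum fine sector whose
bottom is within `ε` of the coarse bottom has ground-space-AVERAGE d-wave order `≥ a L⁴`. -/
def FineBottomLRO (U δ a ε : ℝ) : Prop :=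
  let H := hubbardTorus 2 L 1 U
  let N := 2 * ⌊(1 - δ) * (L : ℝ) ^ 2 / 2⌋₊
  let P := (pairField dWaveFormFactor L)ᴴ * pairField dWaveFormFactor L
  ∀ Γ : D4Irrep, Γ.dim = 1 →
    Matrix.minEnergyOn H (fineSector L N Γ) ≤ Matrix.minEnergyOn H (szSector N 0) + ε →
      let PE := projMatrix ((groundSpaceOn L H (fineSector L N Γ)).map
        ((WithLp.linearEquiv 2 ℂ (Fock (Orb (FermionTorus 2 L)))).symm :
          Fock (Orb (FermionTorus 2 L)) →ₗ[ℂ] EuclideanSpace ℂ (Finset (Orb (FermionTorus 2 L)))))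
      a * (L : ℝ) ^ 4 * (PE.trace).re ≤ ((PE * P).trace).re

/-- **BottomMultiplicityFree** (qualitative spectroscopy): the coarse ground space sits inside the span of
the 1-dim-character zero-momentum fine ground spaces, each of which (when at the bottom) is a LINE. -/
def BottomMultiplicityFree (U δ ε : ℝ) : Prop :=
  let H := hubbardTorus 2 L 1 U
  let N := 2 * ⌊(1 - δ) * (L : ℝ) ^ 2 / 2⌋₊
  groundSpaceOn L H (szSector N 0) ≤
      ⨆ Γ ∈ {Γ : D4Irrep | Γ.dim = 1}, groundSpaceOn L H (fineSector L N Γ) ∧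
    ∀ Γ : D4Irrep, Γ.dim = 1 →
      Matrix.minEnergyOn H (fineSector L N Γ) ≤ Matrix.minEnergyOn H (szSector N 0) + ε →
        Module.finrank ℂ (groundSpaceOn L H (fineSector L N Γ)) ≤ 1

/-- Glue of card `chiral-doublet-point-group-schur` (sorried, M-sized, provable now: isotypic
orthogonality, `[Δ_d†Δ_d, U_γ] = 0`, `doublet_min_of_sectors` / `exists_scalar_of_irreducible`). -/
theorem goodAt_of_fine {U δ a ε : ℝ} (hε : 0 < ε) (h1 : FineBottomLRO L U δ a ε)
    (h2 : BottomMultiplicityFree L U δ ε) : GoodAt U δ a L := by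
  sorry

end FineSectors

end Summit.HubbardSuperconductivity.HubbardSuperconductivity.Cruxes.CwThesis.Ideator3
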